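import Summits.ValiantsHypothesis.ValiantsHypothesis.Theses.TwistedDetRank

/-!
# Route TwistedDetRank — `TdrPerFactorial`: the trivial bound `tdr(per_n) ≤ n!`

Support item `TdrPerFactorial` of route `TwistedDetRank` (Valiant's hypothesis): for every `n` the
generic permanent `per_n = per (X_{ij})` is a sum of `n!` Hadamard-twisted determinants
`det (X ∘ E_t)`. The witness is `per_n = ∑_τ det (X ∘ E_τ)` over the permutations `τ` of `Fin n`,
where `E_τ i j = [i = τ j] · a_τ j` is the permutation matrix of `τ` with its columns rescaled by
scalars `a_τ j` of product `sgn τ` (we take `sgn τ` in the column of index `0` and `1` elsewhere):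
in the Leibniz expansion of `det (X ∘ E_τ)` only `σ = τ` survives, with coefficient
`sgn τ · sgn τ = 1`, so `det (X ∘ E_τ) = ∏ⱼ X_{τ j, j}` and the sum over `τ` is the permanent.
The `n!` twists are then enumerated by `Fin n!` through `Fintype.equivFinOfCardEq`.

Main results:
* `det_twist_perm` — `det (C (E i j) · X_{ij}) = sgn τ · C (∏ⱼ a j) · ∏ⱼ X_{τ j, j}` for
  `E i j = [i = τ j] · a j`;
* `perPoly_eq_sum_det_twist_perm` — `per_n = ∑_τ det (X ∘ E_τ)` whenever `∏ⱼ a_τ j = sgn τ`;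
* `tdrPerFactorial_proof : TdrPerFactorial`.
-/

-- `Summit.ValiantsHypothesis.ValiantsHypothesis.…` is the tree's mandated single-conjunct layout
-- (Sub = Summit), so the duplicated namespace component is intended.
set_option linter.dupNamespace false

namespace Summit.ValiantsHypothesis.ValiantsHypothesis.Theorems.TwistedDetRank

open MvPolynomial Equiv

/-- Leibniz expansion of a twisted, column-scaled permutation matrix: for `E i j = [i = τ j] · a j`
the twisted determinant `det (C (E i j) · X_{ij})ᵢⱼ` has the single surviving term `σ = τ`, so it
equals `sgn τ · C (∏ⱼ a j) · ∏ⱼ X_{τ j, j}`. -/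
theorem det_twist_perm {m : Type*} [Fintype m] [DecidableEq m] (τ : Perm m) (a : m → ℂ) :
    (Matrix.of fun i j => C (if i = τ j then a j else 0) * X (i, j) :
        Matrix m m (MvPolynomial (m × m) ℂ)).det =
      ((Equiv.Perm.sign τ : ℤ) : MvPolynomial (m × m) ℂ) * C (∏ j, a j) * ∏ j, X (τ j, j) := by
  rw [Matrix.det_apply', Finset.sum_eq_single τ]
  · simp only [Matrix.of_apply, if_true]
    rw [Finset.prod_mul_distrib, map_prod, mul_assoc]
  · intro σ _ hσ
    obtain ⟨i, hi⟩ : ∃ i, σ i ≠ τ i := not_forall.mp (mt Equiv.ext hσ)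
    rw [Finset.prod_eq_zero (Finset.mem_univ i) (by simp [hi]), mul_zero]
  · exact fun h => absurd (Finset.mem_univ τ) h

/-- The permanent as a sum of `n!` twisted determinants: if the column scalings `a_τ` satisfy
`∏ⱼ a_τ j = sgn τ` for every permutation `τ` of `Fin n`, then
`per_n = ∑_τ det (C (E_τ i j) · X_{ij})ᵢⱼ` with `E_τ i j = [i = τ j] · a_τ j`. -/
theorem perPoly_eq_sum_det_twist_perm (n : ℕ) (a : Perm (Fin n) → Fin n → ℂ)
    (ha : ∀ τ, ∏ j, a τ j = ((Equiv.Perm.sign τ : ℤ) : ℂ)) :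
    Literature.Computability.AlgebraicComplexity.perPoly (Fin n) ℂ =
      ∑ τ : Perm (Fin n), (Matrix.of fun i j => C (if i = τ j then a τ j else 0) * X (i, j) :
        Matrix (Fin n) (Fin n) (MvPolynomial (Fin n × Fin n) ℂ)).det := by
  simp_rw [det_twist_perm, ha, map_intCast, ← Int.cast_mul, Int.units_coe_mul_self, Int.cast_one,
    one_mul]
  rfl

/-- The column scaling `sgn τ` at the column of index `0`, `1` elsewhere, has product `sgn τ`
(for `n = 0` both sides are `1`). -/
theorem prod_ite_val_eq_zero_sign (n : ℕ) (τ : Perm (Fin n)) :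
    ∏ j : Fin n, (if (j : ℕ) = 0 then ((Equiv.Perm.sign τ : ℤ) : ℂ) else 1) =
      ((Equiv.Perm.sign τ : ℤ) : ℂ) := by
  cases n with
  | zero => simp [Subsingleton.elim τ 1]
  | succ k => simp

/-- **`TdrPerFactorial`** (route `TwistedDetRank`, support item): the trivial upper bound
`tdr(per_n) ≤ n!` — for every `n` there are `n!` complex matrices `E_t` with
`per_n = ∑_t det (C (E_t i j) · X_{ij})ᵢⱼ`, namely the sign-twisted permutation matrices
`E_τ = (column 0 scaled by sgn τ) · P_τ`, enumerated by `Fin n! ≃ Perm (Fin n)`. -/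
theorem tdrPerFactorial_proof :
    Summit.ValiantsHypothesis.ValiantsHypothesis.Theses.TwistedDetRank.TdrPerFactorial := by
  unfold Summit.ValiantsHypothesis.ValiantsHypothesis.Theses.TwistedDetRank.TdrPerFactorial
  intro n
  -- enumerate the permutations of `Fin n` by `Fin n!`
  have hcard : Fintype.card (Perm (Fin n)) = Nat.factorial n := by
    rw [Fintype.card_perm, Fintype.card_fin]
  let e : Perm (Fin n) ≃ Fin (Nat.factorial n) := Fintype.equivFinOfCardEq hcard
  obtain ⟨E, hE⟩ : ∃ E : Perm (Fin n) → Matrix (Fin n) (Fin n) ℂ,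
      Literature.Computability.AlgebraicComplexity.perPoly (Fin n) ℂ =
        ∑ τ : Perm (Fin n), (Matrix.of fun i j => C (E τ i j) * X (i, j) :
          Matrix (Fin n) (Fin n) (MvPolynomial (Fin n × Fin n) ℂ)).det :=
    ⟨fun τ i j => if i = τ j then (if (j : ℕ) = 0 then ((Equiv.Perm.sign τ : ℤ) : ℂ) else 1) else 0,
      perPoly_eq_sum_det_twist_perm n
        (fun τ j => if (j : ℕ) = 0 then ((Equiv.Perm.sign τ : ℤ) : ℂ) else 1)
        (prod_ite_val_eq_zero_sign n)⟩
  refine ⟨fun t => E (e.symm t), ?_⟩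
  rw [hE]
  exact Fintype.sum_equiv e _ _ fun τ => by simp only [Equiv.symm_apply_apply]

end Summit.ValiantsHypothesis.ValiantsHypothesis.Theorems.TwistedDetRank
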